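import Summits.Schanuel.Schanuel.Theorems.SoloInformedAE3SharpCondGelfondInput
import Summits.Schanuel.Schanuel.Theorems.SoloInformedAE3SharpCondEventually
import Summits.Schanuel.Schanuel.Theorems.SoloInformedTheoremAE32

/-!
# Theorem AE₃♯-2 (η = 0): `ν > β + (3 − 3σ − τ)/2` is an exponent — conditionally on [Roy2010]

Soloist file (informed mode, seat `solo-Schanuel-informed`, s184).  The kernel form of the
seat's THEOREM AE₃♯-2 (`work/s184/CLUSTER-note.md` §6–§7; `paper/AE-note.md` §15), the
FULL-DEPTH (cluster-weighted) form of THEOREM AE₃-2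
(`soloA32_Ioi_subset_royAdditiveSVEExponents`, threshold `β + 2(1 − σ − τ)` on `2σ + τ > 1`)
on the node `RoyAdditiveDirichletExponent` ([cite: Roy2010, Thm 1.1]; Roy's question there is
whether every `ν > 1 + β − σ − τ` is an exponent), CONDITIONAL on the same two results of
[Roy2010] carried as displayed hypotheses — typed named facts of the Literature tree, not
proved there: the pointwise transfer estimate `(hR1 : cor_3_2)` [cite: Roy2010, Cor 3.2] and
the degree/height bound for the gcd of the prime dilates `(hR2 : thm_1_2)`
[cite: Roy2010, Thm 1.2]:

  for `ξ ∈ ℂ` transcendental, `β > 1`, `0 ≤ τ`, `σ + τ < 1`, `1 + τ < 3σ`: every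
  `ν > β + (3 − 3σ − τ)/2` lies in `royAdditiveSVEExponents ξ β σ τ`.

Mechanism (one `n` at a time, `soloCA_gelfond_input`): that of THEOREM AE₃-2 — prime dilates
`P(aX)`, `a ≤ n^μ`, with derivatives of order `< t ≍ n^τ`; few bad points among `iξ`,
`i ≤ K = ⌊n^{σ-μ}⌋` ([Roy2010, Cor 3.2]); stripping; the dilation gcd of [Roy2010, Thm 1.2] of
degree `≤ N = ⌊n^{1-μ+δ}⌋` and logarithmic height `≤ n^{β-μ+δ}` — except that the rigidity step
at the root-count scale is run at FULL depth `V = n^ν/4` by the cluster-weighted first-moment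
selection (`soloGC_structured_roots`: one random representative per root cluster, budget
`K² V ≫ N² (N/2 + Lg) + N³` priced on `Q̃` itself) instead of the served private root (diluted
depth `V K/(160000 N)`, budget priced on `rad Q̃` with the `t`-divided `D₀ = N/t`,
`L₀ = (N/2 + Lg)/t`).  Gel'fond's criterion
(`Literature.NumberTheory.Transcendental.gelfond_criterion_not_small_values`) is run with
`(N+1)^{e₁}`, `(N+1)^{e₂}`, `e₁ = 1 − σ − τ + δ + κ`, `e₂ = β − σ − τ + δ + κ`, `κ = ε₀/4`,
`ε₀ = ν − β − (3 − 3σ − τ)/2 > 0`.  Parameters: `μ = (1 − σ + τ)/2` (`< σ` iff `1 + τ < 3σ`),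
`δ = ε₀/20`; the binding constraints are the rigidity budget `ν > 2 + β − 2σ − μ + 3δ`
(`soloCE_condD`) and the transfer condition `ν > 1 + β − σ − τ + μ` (`soloAW_condB`), which
balance exactly at `μ = (1 − σ + τ)/2`.  The threshold improves THEOREM AE₃♯-1's unconditional
`2 + β − 2σ` throughout the range, improves THEOREM AE₃-2's `β + 2(1 − σ − τ)` iff `σ + 3τ < 1`
(the full-depth budget is blind to `t`, so for larger `τ` the `t³`-division of AE₃-2 wins; at
`τ = 0` it is `β + (3/2)(1 − σ)` against `β + 2(1 − σ)`, on `σ > 1/3` against `σ > 1/2`), lies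
below the one-point Gel'fond ceiling `1 + β` throughout, improves [Roy2010, (3)]
`1 + β − (3/4)σ − τ` iff `3σ > 2 + 2τ`, and tends to `β + τ` as `σ → 1 − τ` (where Roy's
conjectured `1 + β − σ − τ` tends to `β`); the gap to that floor is `(1 − σ + τ)/2`.

What this is NOT.  Conditional on [cite: Roy2010, Cor 3.2] and [cite: Roy2010, Thm 1.2] as
displayed; not the node `RoyAdditiveDirichletExponent`, whose window above `1 + β − σ − τ`
stays open; the `η > 0` form is not formalised; and nothing here bears on
`Literature.Periods.SchanuelConjecture` (the seat's verdict, no path, is unchanged).  Tree files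
and Mathlib only; no definitions; axioms the standard three.
-/

namespace Summit.Schanuel.Schanuel.Theorems

open Polynomial Finset Filter
open Literature.NumberTheory.Transcendental.Roy2010 (cor_3_2 thm_1_2 primesLe dilationGcd)

/-- **THEOREM AE₃♯-2, `η = 0` (kernel form, conditional on [Roy2010, Cor 3.2 and Thm 1.2]).**
For `ξ` transcendental, `β > 1`, `0 ≤ τ`, `σ + τ < 1`, `1 + τ < 3σ` (so `σ > 1/3`): every
`ν > β + (3 − 3σ − τ)/2` is an exponent of Roy's additive small value estimate at the
points `iξ` with derivatives of order `≤ n^τ`, i.e.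
`Set.Ioi (β + (3 - 3σ - τ)/2) ⊆ royAdditiveSVEExponents ξ β σ τ`. -/
theorem soloCA_Ioi_subset_royAdditiveSVEExponents (hR1 : cor_3_2) (hR2 : thm_1_2) {ξ : ℂ}
    (hξ : Transcendental ℚ ξ) {β σ τ : ℝ} (hβ : 1 < β) (hτ0 : 0 ≤ τ) (hστ : σ + τ < 1)
    (h31 : 1 + τ < 3 * σ) :
    Set.Ioi (β + (3 - 3 * σ - τ) / 2) ⊆ royAdditiveSVEExponents ξ β σ τ := by
  intro ν hν
  rw [Set.mem_Ioi] at hν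
  by_contra hcon
  have hev : ∀ᶠ n : ℕ in atTop, (RoyAdditiveSmall ξ β σ τ ν n).Nonempty :=
    (Filter.not_frequently.mp hcon).mono fun n hn => not_not.mp hn
  have hξ0 : ξ ≠ 0 := by
    intro h
    apply hξ
    rw [h]
    exact isAlgebraic_zero
  have hξpos : 0 < ‖ξ‖ := norm_pos_iff.mpr hξ0
  have hσ1 : σ < 1 := by linarith
  have hu0 : 0 < 1 - σ - τ := by linarith
  have hν1 : 1 < ν := by linarith
  -- the constant `c₁` of the served-set lemma
  set c₁ : ℝ := max 0 (Real.log (2 / ‖ξ‖)) with hc₁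
  have hc : Real.exp (-c₁) ≤ min 1 (‖ξ‖ / 2) := by
    refine le_min ?_ ?_
    · rw [Real.exp_le_one_iff]
      linarith [le_max_left 0 (Real.log (2 / ‖ξ‖))]
    · have h2 : 0 < 2 / ‖ξ‖ := by positivity
      calc Real.exp (-c₁) ≤ Real.exp (-Real.log (2 / ‖ξ‖)) :=
            Real.exp_le_exp.mpr (by linarith [le_max_right 0 (Real.log (2 / ‖ξ‖))])
        _ = ‖ξ‖ / 2 := by rw [Real.exp_neg, Real.exp_log h2, inv_div]
  -- the parameters `μ`, `δ` and the exponents of the comparison sequences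
  set ε₀ : ℝ := ν - β - (3 - 3 * σ - τ) / 2 with hε₀
  have hε₀0 : 0 < ε₀ := by rw [hε₀]; linarith
  set μ : ℝ := (1 - σ + τ) / 2 with hμ
  set δ : ℝ := ε₀ / 20 with hδ
  have hμ0 : 0 < μ := by rw [hμ]; linarith
  have hμσ : μ < σ := by rw [hμ]; linarith
  have hμ1 : μ < 1 := by linarith
  have hδ0 : 0 < δ := by rw [hδ]; linarith
  have ha0 : 0 < 1 - μ + δ := by linarith
  have ha1 : 1 - μ + δ < ν := by rw [hμ, hδ]; linarith
  have hg : 0 < ν + σ - 1 - δ := by rw [hδ]; linarith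
  have hBud : 1 + β + μ < σ + τ + ν := by rw [hμ]; linarith
  have hD : 2 + β - 3 * μ + 3 * δ < 2 * σ - 2 * μ + ν := by
    rw [hμ, hδ]; linarith
  have hE1 : 1 - τ + δ - μ < ν + σ - 1 - δ := by rw [hμ, hδ]; linarith
  have hE2 : β - σ - τ + δ < ν + σ - 1 - δ := by rw [hδ]; linarith
  set κ : ℝ := ε₀ / 4 with hκ
  have hκ0 : 0 < κ := by rw [hκ]; linarith
  set e₁ : ℝ := 1 - σ - τ + δ + κ with he₁
  set e₂ : ℝ := β - σ - τ + δ + κ with he₂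
  have he₁0 : 0 < e₁ := by rw [he₁]; linarith
  have he₂0 : 0 < e₂ := by rw [he₂]; linarith
  have he12 : e₁ ≤ e₂ := by rw [he₁, he₂]; linarith
  have hE : e₁ + e₂ < ν + σ - 1 - δ := by rw [he₁, he₂, hδ, hκ]; linarith
  have hF : 1 - σ - τ + δ < e₁ := by rw [he₁]; linarith
  have hG1 : 1 - σ - τ + δ + κ / 2 < e₂ := by rw [he₂]; linarith
  have hG2 : β - σ - τ + δ < e₂ := by rw [he₂]; linarith
  have hσμ1 : σ - μ ≤ 1 := by linarith
  set a : ℝ := (2 : ℝ) ^ e₂ + 1 with ha_def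
  have h2e₂ : 0 < (2 : ℝ) ^ e₂ := by positivity
  have ha1' : 1 < a := by linarith
  have ha0' : 0 < a := by linarith
  have h2e₁ : (2 : ℝ) ^ e₁ ≤ (2 : ℝ) ^ e₂ :=
    Real.rpow_le_rpow_of_exponent_le (by norm_num) he12
  -- [Roy2010, Thm 1.2] at `(β, δ, μ)`
  obtain ⟨n₀, hn₀⟩ := hR2 β δ μ hδ0 hμ0 hμ1 hβ
  -- all eventual conditions at once
  have hall := hev.and ((eventually_ge_atTop n₀).and ((soloT3_floor (sub_pos.mpr hμσ)).and
    ((soloAV_tfloor hτ0).and ((soloT1_floor ha0).and ((soloAV_Kt hμ0 hμσ hτ0 hστ).and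
    ((soloAV_condV ξ hν1).and ((soloAV_cond1 ha0 ha1 c₁).and
    ((soloCE_cond4 (ν := ν) hμσ ha0 hg).and
    ((soloAV_condA ξ hμ0 hμσ hσ1 (τ := τ) (ν := ν) (by linarith) hν1).and
    ((soloAW_condB hβ hμ0 hμ1.le hμσ hτ0 hBud).and ((soloCE_condD hβ.le hμσ ha0 hD).and
    ((soloCE_condE ξ hβ.le hμσ hτ0 ha0 hE1 hE2).and
    ((soloAV_condF hβ.le hμσ hτ0 ha0 he₁0.le hF).and
    ((soloAV_condG hβ.le hμσ hσμ1 hτ0 ha0 hκ0 he₂0.le hG1 hG2).and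
    (soloCE_condH (ν := ν) hμσ ha0 he₁0.le he₂0.le hE ha0')))))))))))))))
  obtain ⟨N₀, hN₀⟩ := Filter.eventually_atTop.mp hall
  -- the Gel'fond inputs `Q n`, `n ≥ N₀` (junk `1` below `N₀`)
  have hex : ∀ n : ℕ, ∃ Q : ℤ[X], N₀ ≤ n →
      Q ≠ 0 ∧ (Q.natDegree : ℝ) ≤
          20 * (((⌊(n : ℝ) ^ (1 - μ + δ)⌋₊ : ℕ) : ℝ) / ((⌊(n : ℝ) ^ τ / 2⌋₊ + 1 : ℕ) : ℝ)) /
            ⌊(n : ℝ) ^ (σ - μ)⌋₊ ∧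
        Q.gelfondType ≤
          20 * (((⌊(n : ℝ) ^ (1 - μ + δ)⌋₊ : ℕ) : ℝ) / ((⌊(n : ℝ) ^ τ / 2⌋₊ + 1 : ℕ) : ℝ)) /
              ⌊(n : ℝ) ^ (σ - μ)⌋₊ * (2 + Real.log ⌊(n : ℝ) ^ (σ - μ)⌋₊) +
            20 * ((((⌊(n : ℝ) ^ (1 - μ + δ)⌋₊ : ℕ) : ℝ) / 2 + (n : ℝ) ^ (β - μ + δ)) /
              ((⌊(n : ℝ) ^ τ / 2⌋₊ + 1 : ℕ) : ℝ)) / ⌊(n : ℝ) ^ (σ - μ)⌋₊ ∧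
        ‖aeval ξ Q‖ ≤ Real.exp (-((n : ℝ) ^ ν / 4 * ⌊(n : ℝ) ^ (σ - μ)⌋₊ /
          (1600000 * ⌊(n : ℝ) ^ (1 - μ + δ)⌋₊) / 2)) := by
    intro n
    by_cases h : N₀ ≤ n
    · obtain ⟨hne, hn₀n, ⟨hn1, hK, -, -⟩, ⟨ht1, htτ, -, -⟩, ⟨-, hN1, -, -⟩, ⟨hKt, hKx, hx3⟩,
        hcV, hc1, hc4, hcA, hcB, hcD, hcE, -, -, -⟩ := hN₀ n h
      have hn : 1 ≤ n := by exact_mod_cast hn1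
      have hN : 1 ≤ ⌊(n : ℝ) ^ (1 - μ + δ)⌋₊ := le_trans (by norm_num) hN1
      have hLg : (0 : ℝ) ≤ (n : ℝ) ^ (β - μ + δ) := by positivity
      have hR2n : ∀ G : ℤ[X], G ≠ 0 → G.natDegree ≤ n →
          G.supNorm ≤ Real.exp ((n : ℝ) ^ β) → G.coeff 0 ≠ 0 →
          ((dilationGcd (primesLe ((n : ℝ) ^ μ)) G).natDegree : ℝ) ≤
              ((⌊(n : ℝ) ^ (1 - μ + δ)⌋₊ : ℕ) : ℝ) ∧
            (dilationGcd (primesLe ((n : ℝ) ^ μ)) G).supNorm ≤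
              Real.exp ((n : ℝ) ^ (β - μ + δ)) := by
        intro G hG0 hGdeg hGsup hGc
        obtain ⟨h1, h2⟩ := hn₀ n hn₀n G hG0 hGdeg hGsup hGc
        exact ⟨by exact_mod_cast Nat.le_floor h1, h2⟩
      obtain ⟨Q, hQ⟩ := soloCA_gelfond_input hR1 hξ hn hK hN hx3 hKx ht1 htτ hKt hLg hR2n
        hc hcA hcB hcV hc1 hc4 hcD hcE hne.some_mem
      exact ⟨Q, fun _ => hQ⟩
    · exact ⟨1, fun h' => absurd h' h⟩
  choose Q hQ using hex
  -- Gel'fond's criterion with `δ_N = (N+1)^{e₁}`, `σ_N = (N+1)^{e₂}`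
  obtain ⟨hδm, hδ0', -, hδr⟩ := soloT1_seq he₁0
  obtain ⟨hσm, hσ0', hσt, hσr⟩ := soloT1_seq he₂0
  have hδa : ∀ N : ℕ, (((N + 1 : ℕ) : ℝ) + 1) ^ e₁ ≤ a * (((N : ℝ) + 1) ^ e₁) := fun N => by
    have hp : 0 < ((N : ℝ) + 1) ^ e₁ := hδ0' N
    calc (((N + 1 : ℕ) : ℝ) + 1) ^ e₁ ≤ (2 : ℝ) ^ e₁ * ((N : ℝ) + 1) ^ e₁ := hδr N
      _ ≤ a * ((N : ℝ) + 1) ^ e₁ := by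
          apply mul_le_mul_of_nonneg_right _ hp.le
          linarith
  have hσa : ∀ N : ℕ, (((N + 1 : ℕ) : ℝ) + 1) ^ e₂ < a * (((N : ℝ) + 1) ^ e₂) := fun N => by
    have hp : 0 < ((N : ℝ) + 1) ^ e₂ := hσ0' N
    calc (((N + 1 : ℕ) : ℝ) + 1) ^ e₂ ≤ (2 : ℝ) ^ e₂ * ((N : ℝ) + 1) ^ e₂ := hσr N
      _ < a * ((N : ℝ) + 1) ^ e₂ := by
          apply mul_lt_mul_of_pos_right _ hp
          linarith
  have hQcrit : ∀ N, N₀ ≤ N → Q N ≠ 0 ∧ ((Q N).natDegree : ℝ) < ((N : ℝ) + 1) ^ e₁ ∧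
      (Q N).gelfondType < ((N : ℝ) + 1) ^ e₂ := fun N hN => by
    obtain ⟨hQ0, hQd, hQt, -⟩ := hQ N hN
    obtain ⟨-, -, -, -, -, -, -, -, -, -, -, -, -, hF', hG', -⟩ := hN₀ N hN
    exact ⟨hQ0, hQd.trans_lt hF', hQt.trans_lt hG'⟩
  obtain ⟨N, hNN₀, hlow⟩ :=
    Literature.NumberTheory.Transcendental.gelfond_criterion_not_small_values hξ a ha1'
      (fun N : ℕ => ((N : ℝ) + 1) ^ e₁) (fun N : ℕ => ((N : ℝ) + 1) ^ e₂) hδm hσm hδ0' hσ0'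
      hσt hδa hσa Q N₀ hQcrit
  -- compare the two bounds at this `N`
  obtain ⟨-, -, -, hup⟩ := hQ N hNN₀
  obtain ⟨-, -, -, -, -, -, -, -, -, -, -, -, -, -, -, hH⟩ := hN₀ N hNN₀
  have hfin := Real.exp_le_exp.mp (hlow.trans hup)
  linarith

end Summit.Schanuel.Schanuel.Theorems
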